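import Literature.NumberTheory.Automorphic.MeyerThetaMellin
import Literature.NumberTheory.Automorphic.MeyerLogPrimitive
import Mathlib.Analysis.Calculus.SmoothSeries
import Mathlib.Analysis.Calculus.IteratedDeriv.Lemmas
import Mathlib.Analysis.Distribution.SchwartzSpace.Deriv
import Mathlib.Analysis.Fourier.AddCircle
import Mathlib.MeasureTheory.Integral.IntegralEqImproper
import HarnessLib

/-!
# Meyer's global difference representation — proofs, `K = ℚ`: solving the twisted difference
# equation `k(t/e) - e^{s} k(t) = κ(t)` in the Schwartz space

Topic `NumberTheory/Automorphic`; namespace `Literature.NumberTheory.Automorphic.Meyer`. Sibling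
PROOF file (real analysis, Mathlib + `MeyerThetaMellin`) for Step E (upper bound) of the plan for
`Meyer.spectralRealisation_rat` [Meyer2005, Thm. 5.11]. It is the archimedean heart of the upper
bound `mult(|x|^s, π₋) ≤ ord_s Λ`: a joint eigenvector of `π₋` with eigencharacter `|x|^s`,
represented by an unramified `f ∈ H₋`, satisfies `λ_e f - e^{s} f ∈ H₊ ∩ H₋`, so that
`(e^{z} - e^{s}) f̂(z) = ζ(z) Mκ(z)` for an explicit Schwartz function `κ` on `ℝ`; to conclude that
`f` itself lies in `H₊ ∩ H₋` one must SOLVE `k(t/e) - e^{s} k(t) = κ(t)` with `k` Schwartz. Here we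
prove [Meyer2005, Lemma 5.10 / the maximum principle Lemma 4.x, in an elementary form]:

* the candidate `k⁺(t) = -∑_{j ≥ 0} e^{-(j+1)s} κ(e^{-j} t)` (`tdPlus`) converges with all derivatives
  for `Re s > 0`, is smooth, solves the equation (`tdPlus_functional_eq`), and
  `(k⁺)' = tdPlus (s+1) (e κ')` (`deriv_tdPlus`);
* the second candidate `k⁻(t) = ∑_{j ≥ 1} e^{(j-1)s} κ(e^{j} t)` (`tdMinus`) converges on `t ≠ 0`,
  solves the equation there and decays faster than any power at infinity (`norm_tdMinus_le`);
* **`tdPlus_eq_tdMinus`** — if `Mκ(s + 2πik) = 0` for all `k ∈ ℤ` then `k⁺ = k⁻` on `(0, ∞)`: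
  the difference `D` satisfies `D(t/e) = e^{s} D(t)` and the `1`-periodic continuous function
  `y ↦ D(e^y) e^{sy}` has all Fourier coefficients `-e^{-s} Mκ(s + 2πik) = 0` (a telescoping of
  `∑_j ∫` over the partition of `(0, ∞)` into the intervals `(e^{-j}, e^{-j+1}]`, `(e^{j+1}, e^{j+2}]`),
  hence vanishes by Parseval;
* **`exists_schwartz_twistedDifference`** — consequently `k⁺` is a Schwartz function (of the same
  parity as `κ`) solving the twisted difference equation.

Everything is proved; the definitions are `tdPlus`, `tdMinus`.

## References

* R. Meyer, *On a representation of the idele class group related to primes and zeros of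
  L-functions*, Duke Math. J. 127 (2005) = arXiv:math/0311468, Lemma 5.10, Thm. 5.11 [Meyer2005].
-/

noncomputable section

open MeasureTheory Set Filter Complex
open scoped Topology Real ContDiff

namespace Literature.NumberTheory.Automorphic.Meyer

/-! ### The two candidate solutions -/

/-- **`k⁺(t) = -∑_{j ≥ 0} e^{-(j+1)s} κ(e^{-j} t)`.** [cite: Meyer2005, Lemma 5.10] -/
def tdPlus (s : ℂ) (κ : ℝ → ℂ) (t : ℝ) : ℂ :=
  ∑' j : ℕ, -(cexp (-((j + 1 : ℕ) : ℂ) * s) * κ (Real.exp (-(j : ℝ)) * t))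

/-- **`k⁻(t) = ∑_{j ≥ 1} e^{(j-1)s} κ(e^{j} t)`.** [cite: Meyer2005, Lemma 5.10] -/
def tdMinus (s : ℂ) (κ : ℝ → ℂ) (t : ℝ) : ℂ :=
  ∑' j : ℕ, cexp (((j : ℕ) : ℂ) * s) * κ (Real.exp ((j + 1 : ℕ) : ℝ) * t)

/-! ### Convergence and smoothness of `k⁺` -/

section Plus

variable (s : ℂ) (κ : SchwartzMap ℝ ℂ)

/-- The terms of `k⁺`. [folklore] -/
def tdPlusTerm (j : ℕ) (t : ℝ) : ℂ := -(cexp (-((j + 1 : ℕ) : ℂ) * s) * κ (Real.exp (-(j : ℝ)) * t))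

/-- Each term is smooth. [folklore] -/
theorem contDiff_tdPlusTerm (j : ℕ) : ContDiff ℝ ∞ (tdPlusTerm s κ j) := by
  unfold tdPlusTerm
  exact (contDiff_const.mul ((κ.smooth ⊤).comp (contDiff_const.mul contDiff_id))).neg

/-- Norm of the exponential factor. [folklore] -/
theorem norm_cexp_neg_nat_mul (j : ℕ) : ‖cexp (-((j + 1 : ℕ) : ℂ) * s)‖ = Real.exp (-((j + 1 : ℕ) : ℝ) * s.re) := by
  rw [Complex.norm_exp]
  congr 1
  simp [Complex.mul_re]

/-- **Uniform bounds on the derivatives of the terms**: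
`‖Dⁿ(tdPlusTerm j)(t)‖ ≤ e^{-(j+1) Re s} e^{-jn} ‖κ‖_{0,n}`. [folklore] -/
theorem norm_iteratedFDeriv_tdPlusTerm_le (j n : ℕ) (t : ℝ) :
    ‖iteratedFDeriv ℝ n (tdPlusTerm s κ j) t‖ ≤
      Real.exp (-((j + 1 : ℕ) : ℝ) * s.re) * Real.exp (-(j : ℝ)) ^ n * SchwartzMap.seminorm ℝ 0 n κ := by
  rw [norm_iteratedFDeriv_eq_norm_iteratedDeriv]
  have hsmooth : ContDiff ℝ n (fun t : ℝ => κ t) := κ.smooth n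
  have h1 : iteratedDeriv n (tdPlusTerm s κ j) t =
      -(cexp (-((j + 1 : ℕ) : ℂ) * s) * ((Real.exp (-(j : ℝ))) ^ n • iteratedDeriv n (fun t : ℝ => κ t) (Real.exp (-(j : ℝ)) * t))) := by
    have hcomp := congrFun (iteratedDeriv_comp_const_smul (n := n) hsmooth (Real.exp (-(j : ℝ)))) t
    have hfun : tdPlusTerm s κ j = fun t => -(cexp (-((j + 1 : ℕ) : ℂ) * s) * (fun x => κ (Real.exp (-(j : ℝ)) * x)) t) := rfl
    rw [hfun, iteratedDeriv_fun_neg, iteratedDeriv_const_mul _ ?_, hcomp]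
    exact (((κ.smooth n).comp (contDiff_const.mul contDiff_id)).contDiffAt)
  rw [h1, norm_neg, norm_mul, norm_cexp_neg_nat_mul, norm_smul, Real.norm_eq_abs, abs_pow,
    abs_of_pos (Real.exp_pos _), mul_assoc]
  gcongr
  have := SchwartzMap.norm_iteratedFDeriv_le_seminorm ℝ κ n (Real.exp (-(j : ℝ)) * t)
  rwa [norm_iteratedFDeriv_eq_norm_iteratedDeriv] at this

/-- The bounds are summable in `j` (geometric series). [folklore] -/
theorem summable_tdPlus_bound (hs : 0 < s.re) (n : ℕ) :
    Summable fun j : ℕ => Real.exp (-((j + 1 : ℕ) : ℝ) * s.re) * Real.exp (-(j : ℝ)) ^ n * SchwartzMap.seminorm ℝ 0 n κ := by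
  have hgeom : Summable fun j : ℕ => (Real.exp (-s.re)) ^ j := by
    refine summable_geometric_of_lt_one (Real.exp_pos _).le ?_
    rw [← Real.exp_zero]
    exact Real.exp_lt_exp.mpr (by linarith)
  refine ((hgeom.mul_left (Real.exp (-s.re) * SchwartzMap.seminorm ℝ 0 n κ))).of_nonneg_of_le
    (fun j => by positivity) fun j => ?_
  have h1 : Real.exp (-(j : ℝ)) ^ n ≤ 1 := pow_le_one₀ (Real.exp_pos _).le (by
    rw [← Real.exp_zero]; exact Real.exp_le_exp.mpr (neg_nonpos.mpr (Nat.cast_nonneg j)))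
  have h2 : Real.exp (-((j + 1 : ℕ) : ℝ) * s.re) = Real.exp (-s.re) * Real.exp (-s.re) ^ j := by
    rw [← Real.exp_nat_mul, ← Real.exp_add]
    congr 1
    push_cast
    ring
  rw [h2]
  calc Real.exp (-s.re) * Real.exp (-s.re) ^ j * Real.exp (-(j : ℝ)) ^ n * SchwartzMap.seminorm ℝ 0 n κ
      ≤ Real.exp (-s.re) * Real.exp (-s.re) ^ j * 1 * SchwartzMap.seminorm ℝ 0 n κ := by
        gcongr
    _ = Real.exp (-s.re) * SchwartzMap.seminorm ℝ 0 n κ * Real.exp (-s.re) ^ j := by ring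

/-- `k⁺` as the sum of its terms. [folklore] -/
theorem tdPlus_eq_tsum : tdPlus s κ = fun t => ∑' j : ℕ, tdPlusTerm s κ j t := rfl

/-- **`k⁺` is smooth.** [cite: Meyer2005, Lemma 5.10] -/
theorem contDiff_tdPlus (hs : 0 < s.re) : ContDiff ℝ ∞ (tdPlus s κ) := by
  rw [tdPlus_eq_tsum]
  exact contDiff_tsum (fun j => contDiff_tdPlusTerm s κ j) (fun n _ => summable_tdPlus_bound s κ hs n)
    fun n j t _ => norm_iteratedFDeriv_tdPlusTerm_le s κ j n t

/-- The iterated derivatives of `k⁺` are the sums of those of the terms. [folklore] -/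
theorem iteratedFDeriv_tdPlus (hs : 0 < s.re) (n : ℕ) (t : ℝ) :
    iteratedFDeriv ℝ n (tdPlus s κ) t = ∑' j : ℕ, iteratedFDeriv ℝ n (tdPlusTerm s κ j) t := by
  rw [tdPlus_eq_tsum]
  exact iteratedFDeriv_tsum_apply (N := (⊤ : ℕ∞)) (fun j => (contDiff_tdPlusTerm s κ j).of_le (mod_cast le_top))
    (fun n _ => summable_tdPlus_bound s κ hs n)
    (fun n j t _ => norm_iteratedFDeriv_tdPlusTerm_le s κ j n t) (mod_cast le_top) t

/-- **A priori bound on the derivatives of `k⁺`** (no decay yet). [folklore] -/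
theorem norm_iteratedFDeriv_tdPlus_le (hs : 0 < s.re) (n : ℕ) :
    ∃ C : ℝ, ∀ t : ℝ, ‖iteratedFDeriv ℝ n (tdPlus s κ) t‖ ≤ C := by
  refine ⟨∑' j : ℕ, Real.exp (-((j + 1 : ℕ) : ℝ) * s.re) * Real.exp (-(j : ℝ)) ^ n * SchwartzMap.seminorm ℝ 0 n κ,
    fun t => ?_⟩
  rw [iteratedFDeriv_tdPlus s κ hs n t]
  exact tsum_of_norm_bounded (summable_tdPlus_bound s κ hs n).hasSum fun j => norm_iteratedFDeriv_tdPlusTerm_le s κ j n t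

/-- Pointwise summability of the series defining `k⁺`. [folklore] -/
theorem summable_tdPlusTerm (hs : 0 < s.re) (t : ℝ) : Summable fun j : ℕ => tdPlusTerm s κ j t := by
  refine Summable.of_norm_bounded (summable_tdPlus_bound s κ hs 0) fun j => ?_
  have := norm_iteratedFDeriv_tdPlusTerm_le s κ j 0 t
  rwa [norm_iteratedFDeriv_zero] at this

/-- **The twisted difference equation for `k⁺`**: `k⁺(t/e) - e^{s} k⁺(t) = κ(t)`. [cite: Meyer2005, Lemma 5.10] -/
theorem tdPlus_functional_eq (hs : 0 < s.re) (t : ℝ) :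
    tdPlus s κ (Real.exp (-1) * t) - cexp s * tdPlus s κ t = κ t := by
  have h1 : tdPlus s κ (Real.exp (-1) * t) = ∑' j : ℕ, tdPlusTerm s κ (j + 1) t * cexp s := by
    rw [tdPlus]
    refine tsum_congr fun j => ?_
    rw [tdPlusTerm, ← mul_assoc, ← Real.exp_add]
    have he : -((j : ℝ)) + -1 = -((j + 1 : ℕ) : ℝ) := by push_cast; ring
    rw [he]
    have hexp : cexp (-((j + 1 : ℕ) : ℂ) * s) = cexp (-((j + 1 + 1 : ℕ) : ℂ) * s) * cexp s := by
      rw [← Complex.exp_add]; congr 1; push_cast; ring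
    rw [hexp]
    ring
  have h2 : cexp s * tdPlus s κ t = ∑' j : ℕ, tdPlusTerm s κ j t * cexp s := by
    rw [tdPlus, ← tsum_mul_left]
    refine tsum_congr fun j => ?_
    rw [tdPlusTerm]; ring
  rw [h1, h2]
  have hsum : Summable fun j : ℕ => tdPlusTerm s κ j t * cexp s := (summable_tdPlusTerm s κ hs t).mul_right _
  rw [hsum.tsum_eq_zero_add]
  have h0 : tdPlusTerm s κ 0 t * cexp s = -κ t := by
    have : cexp (-((0 + 1 : ℕ) : ℂ) * s) * cexp s = 1 := by
      rw [← Complex.exp_add]; push_cast; ring_nf; exact Complex.exp_zero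
    rw [tdPlusTerm, Nat.cast_zero, neg_zero, Real.exp_zero, one_mul, neg_mul, mul_right_comm, this, one_mul]
  rw [h0]
  ring

/-- Parity is inherited: if `κ(-t) = σ κ(t)` then `k⁺(-t) = σ k⁺(t)`. [folklore] -/
theorem tdPlus_neg {σ : ℂ} (hpar : ∀ t, κ (-t) = σ * κ t) (t : ℝ) : tdPlus s κ (-t) = σ * tdPlus s κ t := by
  rw [tdPlus, tdPlus, ← tsum_mul_left]
  refine tsum_congr fun j => ?_
  rw [mul_neg, hpar]
  ring

end Plus

/-! ### The derivative of `k⁺` is again a `k⁺` -/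

section Deriv

variable (s : ℂ) (κ : SchwartzMap ℝ ℂ)

/-- The rescaled derivative `e · κ'` as a Schwartz function. [folklore] -/
def scaledDeriv (κ : SchwartzMap ℝ ℂ) : SchwartzMap ℝ ℂ := (Real.exp 1 : ℂ) • SchwartzMap.derivCLM ℝ ℂ κ

/-- Values of `scaledDeriv`. [folklore] -/
@[simp]
theorem scaledDeriv_apply (t : ℝ) : scaledDeriv κ t = (Real.exp 1 : ℂ) * deriv (fun t : ℝ => κ t) t := by
  simp [scaledDeriv, SchwartzMap.derivCLM_apply]

/-- Parity flips under differentiation. [folklore] -/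
theorem deriv_neg_of_parity {σ : ℂ} (hpar : ∀ t, κ (-t) = σ * κ t) (t : ℝ) :
    deriv (fun t : ℝ => κ t) (-t) = -σ * deriv (fun t : ℝ => κ t) t := by
  have hfun : (fun t : ℝ => κ (-t)) = fun t : ℝ => σ * κ t := funext hpar
  have h1 : deriv (fun t : ℝ => κ (-t)) t = -deriv (fun t : ℝ => κ t) (-t) := deriv_comp_neg (fun t : ℝ => κ t) t
  have h2 : deriv (fun t : ℝ => κ (-t)) t = σ * deriv (fun t : ℝ => κ t) t := by
    rw [hfun, deriv_const_mul _ κ.differentiable.differentiableAt]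
  have := h1.symm.trans h2
  linear_combination -this

/-- Parity flips under `scaledDeriv`. [folklore] -/
theorem scaledDeriv_neg {σ : ℂ} (hpar : ∀ t, κ (-t) = σ * κ t) (t : ℝ) : scaledDeriv κ (-t) = -σ * scaledDeriv κ t := by
  rw [scaledDeriv_apply, scaledDeriv_apply, deriv_neg_of_parity κ hpar t]
  ring

/-- **`(k⁺)' = k⁺(s+1, e κ')`.** [folklore] -/
theorem deriv_tdPlus (hs : 0 < s.re) :
    deriv (tdPlus s κ) = tdPlus (s + 1) (scaledDeriv κ) := by
  funext t
  rw [tdPlus_eq_tsum]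
  have hdiff : ∀ j, Differentiable ℝ (tdPlusTerm s κ j) := fun j =>
    (contDiff_tdPlusTerm s κ j).differentiable (by simp)
  have hbound : ∀ j y, ‖deriv (tdPlusTerm s κ j) y‖ ≤
      Real.exp (-((j + 1 : ℕ) : ℝ) * s.re) * Real.exp (-(j : ℝ)) ^ 1 * SchwartzMap.seminorm ℝ 0 1 κ := by
    intro j y
    have := norm_iteratedFDeriv_tdPlusTerm_le s κ j 1 y
    rwa [norm_iteratedFDeriv_eq_norm_iteratedDeriv, iteratedDeriv_one] at this
  rw [deriv_tsum_apply (summable_tdPlus_bound s κ hs 1) hdiff hbound (summable_tdPlusTerm s κ hs 0) t, tdPlus]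
  refine tsum_congr fun j => ?_
  -- derivative of the `j`-th term
  have hd : deriv (tdPlusTerm s κ j) t =
      -(cexp (-((j + 1 : ℕ) : ℂ) * s) * ((Real.exp (-(j : ℝ)) : ℂ) * deriv (fun t : ℝ => κ t) (Real.exp (-(j : ℝ)) * t))) := by
    have hκ : HasDerivAt (fun u : ℝ => κ (Real.exp (-(j : ℝ)) * u))
        (((Real.exp (-(j : ℝ)) : ℝ) : ℂ) * deriv (fun t : ℝ => κ t) (Real.exp (-(j : ℝ)) * t)) t := by
      have h1 : HasDerivAt (fun u : ℝ => Real.exp (-(j : ℝ)) * u) (Real.exp (-(j : ℝ))) t := by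
        simpa using (hasDerivAt_id t).const_mul (Real.exp (-(j : ℝ)))
      have h2 := (κ.differentiable.differentiableAt (x := Real.exp (-(j : ℝ)) * t)).hasDerivAt
      have h3 := h2.scomp t h1
      exact h3.congr_deriv (by rw [Complex.real_smul])
    have h : HasDerivAt (tdPlusTerm s κ j)
        (-(cexp (-((j + 1 : ℕ) : ℂ) * s) * (((Real.exp (-(j : ℝ)) : ℝ) : ℂ) * deriv (fun t : ℝ => κ t) (Real.exp (-(j : ℝ)) * t)))) t :=
      (hκ.const_mul (cexp (-((j + 1 : ℕ) : ℂ) * s))).neg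
    exact h.deriv
  rw [hd, scaledDeriv_apply]
  have hexp : cexp (-((j + 1 : ℕ) : ℂ) * s) * ((Real.exp (-(j : ℝ)) : ℂ)) =
      cexp (-((j + 1 : ℕ) : ℂ) * (s + 1)) * (Real.exp 1 : ℂ) := by
    rw [Complex.ofReal_exp, Complex.ofReal_exp, ← Complex.exp_add, ← Complex.exp_add]
    congr 1
    push_cast
    ring
  linear_combination (deriv (fun t : ℝ => κ t) (Real.exp (-(j : ℝ)) * t)) * (-hexp)

/-- Mellin transform of the rescaled derivative: `M(e κ')(z) = -e (z-1) Mκ(z-1)` for `Re z > 1`.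
[folklore] -/
theorem mellin_scaledDeriv {z : ℂ} (hz : 1 < z.re) :
    mellin (fun t : ℝ => scaledDeriv κ t) z = -(Real.exp 1 : ℂ) * (z - 1) * mellin (fun t : ℝ => κ t) (z - 1) := by
  -- integration by parts on `(0, ∞)`
  have hu : ∀ x ∈ Ioi (0 : ℝ), HasDerivAt (fun t : ℝ => (t : ℂ) ^ (z - 1)) ((z - 1) * (x : ℂ) ^ (z - 1 - 1)) x := fun x hx =>
    (Complex.hasStrictDerivAt_cpow_const (Complex.ofReal_mem_slitPlane.2 hx)).hasDerivAt.comp_ofReal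
  have hv : ∀ x ∈ Ioi (0 : ℝ), HasDerivAt (fun t : ℝ => κ t) (deriv (fun t : ℝ => κ t) x) x :=
    fun x _ => κ.differentiable.differentiableAt.hasDerivAt
  have hz0 : 0 < (z - 1).re := by simp; linarith
  have huv' : IntegrableOn ((fun t : ℝ => (t : ℂ) ^ (z - 1)) * fun t : ℝ => deriv (fun t : ℝ => κ t) t) (Ioi 0) := by
    have := mellinConvergent_schwartz (SchwartzMap.derivCLM ℝ ℂ κ) (s := z) (by linarith)
    refine IntegrableOn.congr_fun this (fun t _ => by simp [SchwartzMap.derivCLM_apply]) measurableSet_Ioi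
  have hu'v : IntegrableOn ((fun t : ℝ => (z - 1) * (t : ℂ) ^ (z - 1 - 1)) * fun t : ℝ => κ t) (Ioi 0) := by
    have := Integrable.const_mul (mellinConvergent_schwartz κ hz0) (z - 1)
    refine IntegrableOn.congr_fun this (fun t _ => ?_) measurableSet_Ioi
    simp only [Pi.mul_apply, smul_eq_mul]; ring
  have h_zero : Tendsto ((fun t : ℝ => (t : ℂ) ^ (z - 1)) * fun t : ℝ => κ t) (𝓝[>] 0) (𝓝 0) := by
    -- `‖t^{z-1} κ(t)‖ ≤ t^{Re z - 1} C → 0`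
    have hC := SchwartzMap.norm_le_seminorm ℝ κ
    have h1 : Tendsto (fun t : ℝ => t ^ (z.re - 1) * SchwartzMap.seminorm ℝ 0 0 κ) (𝓝[>] 0) (𝓝 0) := by
      have : Tendsto (fun t : ℝ => t ^ (z.re - 1)) (𝓝[>] 0) (𝓝 0) := by
        have h := Real.continuousAt_rpow_const 0 (z.re - 1) (Or.inr (by linarith))
        have h' := h.tendsto
        rw [Real.zero_rpow (by linarith)] at h'
        exact h'.mono_left nhdsWithin_le_nhds
      simpa using this.mul_const (SchwartzMap.seminorm ℝ 0 0 κ)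
    refine squeeze_zero_norm' ?_ h1
    filter_upwards [self_mem_nhdsWithin] with t ht
    rw [Pi.mul_apply, norm_mul, Complex.norm_cpow_eq_rpow_re_of_pos ht, Complex.sub_re, Complex.one_re]
    exact mul_le_mul_of_nonneg_left (hC t) (Real.rpow_nonneg (le_of_lt ht) _)
  have h_infty : Tendsto ((fun t : ℝ => (t : ℂ) ^ (z - 1)) * fun t : ℝ => κ t) atTop (𝓝 0) := by
    -- `‖t^{z-1} κ(t)‖ ≤ t^{Re z-1} · C₂ t^{-2} · … → 0`: use the seminorm `‖t‖^N ‖κ t‖ ≤ C`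
    obtain ⟨N, hN⟩ : ∃ N : ℕ, z.re - 1 < N := exists_nat_gt _
    have hC := SchwartzMap.le_seminorm ℝ (N + 1) 0 κ
    have hpos : 0 < (N : ℝ) + 1 - (z.re - 1) := by linarith
    have hlim : Tendsto (fun t : ℝ => t ^ (-((N : ℝ) + 1 - (z.re - 1))) * SchwartzMap.seminorm ℝ (N + 1) 0 κ) atTop (𝓝 0) := by
      simpa using (tendsto_rpow_neg_atTop hpos).mul_const (SchwartzMap.seminorm ℝ (N + 1) 0 κ)
    refine squeeze_zero_norm' ?_ hlim
    filter_upwards [eventually_ge_atTop (1 : ℝ)] with t ht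
    have ht0 : 0 < t := by linarith
    rw [Pi.mul_apply, norm_mul, Complex.norm_cpow_eq_rpow_re_of_pos ht0, Complex.sub_re, Complex.one_re]
    have h := hC t
    rw [norm_iteratedFDeriv_zero, Real.norm_of_nonneg ht0.le] at h
    -- `‖κ t‖ ≤ C / t^{N+1}`
    have hκ : ‖κ t‖ ≤ SchwartzMap.seminorm ℝ (N + 1) 0 κ / t ^ (N + 1) := by
      rw [le_div_iff₀ (by positivity), mul_comm]; exact h
    calc t ^ (z.re - 1) * ‖κ t‖ ≤ t ^ (z.re - 1) * (SchwartzMap.seminorm ℝ (N + 1) 0 κ / t ^ (N + 1)) := by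
          gcongr
      _ = t ^ (-((N : ℝ) + 1 - (z.re - 1))) * SchwartzMap.seminorm ℝ (N + 1) 0 κ := by
          rw [div_eq_mul_inv, ← Real.rpow_natCast, ← Real.rpow_neg ht0.le, mul_left_comm, ← Real.rpow_add ht0,
            show z.re - 1 + -((N + 1 : ℕ) : ℝ) = -((N : ℝ) + 1 - (z.re - 1)) by push_cast; ring, mul_comm]
  have h := integral_Ioi_mul_deriv_eq_deriv_mul hu hv huv' hu'v h_zero h_infty
  simp only [sub_zero] at h
  -- `h : ∫ t^{z-1} κ' = -∫ (z-1) t^{z-2} κ`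
  have hl : mellin (fun t : ℝ => scaledDeriv κ t) z = (Real.exp 1 : ℂ) * ∫ t in Ioi (0 : ℝ), (t : ℂ) ^ (z - 1) * deriv (fun t : ℝ => κ t) t := by
    rw [mellin, ← integral_const_mul]
    refine setIntegral_congr_fun measurableSet_Ioi fun t _ => ?_
    rw [scaledDeriv_apply, smul_eq_mul]; ring
  have hr : (∫ t in Ioi (0 : ℝ), (z - 1) * (t : ℂ) ^ (z - 1 - 1) * κ t) = (z - 1) * mellin (fun t : ℝ => κ t) (z - 1) := by
    rw [mellin, ← integral_const_mul]
    refine setIntegral_congr_fun measurableSet_Ioi fun t _ => ?_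
    rw [smul_eq_mul]; ring
  rw [hl, h, hr]
  ring

/-- The vanishing hypothesis passes to the rescaled derivative with `s + 1`. [folklore] -/
theorem mellin_scaledDeriv_eq_zero {s : ℂ} (hs : 0 < s.re)
    (hvan : ∀ k : ℤ, mellin (fun t : ℝ => κ t) (s + 2 * π * k * I) = 0) (k : ℤ) :
    mellin (fun t : ℝ => scaledDeriv κ t) (s + 1 + 2 * π * k * I) = 0 := by
  have hz : 1 < (s + 1 + 2 * π * k * I).re := by simp; linarith
  rw [mellin_scaledDeriv κ hz, show s + 1 + 2 * π * k * I - 1 = s + 2 * π * k * I by ring, hvan k, mul_zero]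

end Deriv

/-! ### Convergence and decay of `k⁻` away from `0` -/

section Minus

variable (s : ℂ) (κ : SchwartzMap ℝ ℂ)

/-- The terms of `k⁻`. [folklore] -/
def tdMinusTerm (j : ℕ) (t : ℝ) : ℂ := cexp (((j : ℕ) : ℂ) * s) * κ (Real.exp ((j + 1 : ℕ) : ℝ) * t)

/-- `k⁻` as the sum of its terms. [folklore] -/
theorem tdMinus_eq_tsum : tdMinus s κ = fun t => ∑' j : ℕ, tdMinusTerm s κ j t := rfl

/-- **Bounds on the terms of `k⁻` on `|t| ≥ δ`**: `‖tdMinusTerm j t‖ ≤ e^{j Re s} e^{-(j+1)N} δ^{-N} ‖κ‖_{N,0}`.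
[folklore] -/
theorem norm_tdMinusTerm_le (N : ℕ) {δ : ℝ} (hδ : 0 < δ) (j : ℕ) {t : ℝ} (ht : δ ≤ |t|) :
    ‖tdMinusTerm s κ j t‖ ≤ Real.exp ((j : ℝ) * s.re) * ((Real.exp ((j + 1 : ℕ) : ℝ) * δ) ^ N)⁻¹ * SchwartzMap.seminorm ℝ N 0 κ := by
  have ht0 : 0 < |t| := lt_of_lt_of_le hδ ht
  have hu : 0 < Real.exp ((j + 1 : ℕ) : ℝ) * |t| := mul_pos (Real.exp_pos _) ht0
  have hC := SchwartzMap.le_seminorm ℝ N 0 κ (Real.exp ((j + 1 : ℕ) : ℝ) * t)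
  rw [norm_iteratedFDeriv_zero, Real.norm_eq_abs, abs_mul, abs_of_pos (Real.exp_pos _)] at hC
  rw [tdMinusTerm, norm_mul, Complex.norm_exp]
  have hre : (((j : ℕ) : ℂ) * s).re = (j : ℝ) * s.re := by simp [Complex.mul_re]
  rw [hre, mul_assoc]
  gcongr
  -- `‖κ(e^{j+1} t)‖ ≤ C / (e^{j+1}|t|)^N ≤ C / (e^{j+1} δ)^N`
  have h1 : ‖κ (Real.exp ((j + 1 : ℕ) : ℝ) * t)‖ ≤ SchwartzMap.seminorm ℝ N 0 κ / (Real.exp ((j + 1 : ℕ) : ℝ) * |t|) ^ N := by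
    rw [le_div_iff₀ (pow_pos hu N), mul_comm]; exact hC
  refine h1.trans ?_
  rw [div_eq_mul_inv, mul_comm]
  refine mul_le_mul_of_nonneg_right ?_ (apply_nonneg (SchwartzMap.seminorm ℝ N 0) κ)
  refine inv_anti₀ (pow_pos (mul_pos (Real.exp_pos _) hδ) N) ?_
  exact pow_le_pow_left₀ (by positivity) (by gcongr) N

/-- The bounds are summable for `N > Re s`. [folklore] -/
theorem summable_tdMinus_bound {N : ℕ} (hN : s.re < N) (δ : ℝ) :
    Summable fun j : ℕ => Real.exp ((j : ℝ) * s.re) * ((Real.exp ((j + 1 : ℕ) : ℝ) * δ) ^ N)⁻¹ * SchwartzMap.seminorm ℝ N 0 κ := by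
  have hq : Real.exp (s.re - N) < 1 := by
    rw [← Real.exp_zero]; exact Real.exp_lt_exp.mpr (by linarith)
  have hgeom : Summable fun j : ℕ => (Real.exp (s.re - N)) ^ j := summable_geometric_of_lt_one (Real.exp_pos _).le hq
  refine (hgeom.mul_left ((Real.exp (N : ℝ) * δ ^ N)⁻¹ * SchwartzMap.seminorm ℝ N 0 κ)).congr fun j => ?_
  have : ((Real.exp ((j + 1 : ℕ) : ℝ) * δ) ^ N)⁻¹ = (Real.exp (N : ℝ) * δ ^ N)⁻¹ * Real.exp (-(j : ℝ) * N) := by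
    rw [mul_pow, ← Real.exp_nat_mul, mul_inv, mul_inv]
    have : Real.exp ((N : ℝ) * ((j + 1 : ℕ) : ℝ)) = Real.exp (N : ℝ) * (Real.exp (-(j : ℝ) * N))⁻¹ := by
      rw [← Real.exp_neg, ← Real.exp_add]; congr 1; push_cast; ring
    rw [this, mul_inv, inv_inv]
    ring
  rw [this, ← Real.exp_nat_mul, show (j : ℝ) * (s.re - N) = (j : ℝ) * s.re + -(j : ℝ) * N by ring, Real.exp_add]
  ring

/-- Pointwise summability of the series defining `k⁻` at `t ≠ 0`. [folklore] -/
theorem summable_tdMinusTerm {t : ℝ} (ht : t ≠ 0) : Summable fun j : ℕ => tdMinusTerm s κ j t := by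
  obtain ⟨N, hN⟩ : ∃ N : ℕ, s.re < N := exists_nat_gt _
  exact Summable.of_norm_bounded (summable_tdMinus_bound s κ hN |t|) fun j =>
    norm_tdMinusTerm_le s κ N (abs_pos.mpr ht) j le_rfl

/-- **`k⁻` is continuous at every `t ≠ 0`.** [folklore] -/
theorem continuousAt_tdMinus {t : ℝ} (ht : t ≠ 0) : ContinuousAt (tdMinus s κ) t := by
  obtain ⟨N, hN⟩ : ∃ N : ℕ, s.re < N := exists_nat_gt _
  have hδ : 0 < |t| / 2 := by positivity
  have hcont : ContinuousOn (tdMinus s κ) {u : ℝ | |t| / 2 ≤ |u|} := by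
    rw [tdMinus_eq_tsum]
    refine continuousOn_tsum (fun j => ?_) (summable_tdMinus_bound s κ hN (|t| / 2)) fun j u hu => norm_tdMinusTerm_le s κ N hδ j hu
    unfold tdMinusTerm
    exact (continuous_const.mul (κ.continuous.comp (continuous_const.mul continuous_id))).continuousOn
  refine hcont.continuousAt ?_
  have hopen : IsOpen {u : ℝ | |t| / 2 < |u|} := isOpen_lt continuous_const continuous_abs
  exact Filter.mem_of_superset (hopen.mem_nhds (show |t| / 2 < |t| by linarith [abs_pos.mpr ht]))
    fun u (hu : |t| / 2 < |u|) => (le_of_lt hu : |t| / 2 ≤ |u|)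

/-- **Decay of `k⁻` at infinity**: `|t|^N ‖k⁻(t)‖ ≤ C` for `|t| ≥ 1`, every `N`. [folklore] -/
theorem norm_tdMinus_le (N : ℕ) :
    ∃ C : ℝ, ∀ t : ℝ, 1 ≤ |t| → |t| ^ N * ‖tdMinus s κ t‖ ≤ C := by
  obtain ⟨N', hN'⟩ : ∃ N' : ℕ, max s.re N < N' := exists_nat_gt _
  have hN's : s.re < N' := lt_of_le_of_lt (le_max_left _ _) hN'
  have hNN' : N ≤ N' := by exact_mod_cast (le_max_right s.re N).trans hN'.le
  refine ⟨∑' j : ℕ, Real.exp ((j : ℝ) * s.re) * ((Real.exp ((j + 1 : ℕ) : ℝ) * 1) ^ N')⁻¹ * SchwartzMap.seminorm ℝ N' 0 κ,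
    fun t ht => ?_⟩
  have ht0 : 0 < |t| := lt_of_lt_of_le one_pos ht
  -- at `|t| ≥ 1`: `|t|^N ‖term j‖ ≤ |t|^{N-N'} bound_j ≤ bound_j`
  have hterm : ∀ j, |t| ^ N * ‖tdMinusTerm s κ j t‖ ≤
      Real.exp ((j : ℝ) * s.re) * ((Real.exp ((j + 1 : ℕ) : ℝ) * 1) ^ N')⁻¹ * SchwartzMap.seminorm ℝ N' 0 κ := by
    intro j
    have h := norm_tdMinusTerm_le s κ N' ht0 j le_rfl
    -- `‖term‖ ≤ e^{j Re s} (e^{j+1}|t|)^{-N'} C`, and `|t|^N (e^{j+1}|t|)^{-N'} ≤ (e^{j+1})^{-N'}` as `|t| ≥ 1`, `N ≤ N'`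
    calc |t| ^ N * ‖tdMinusTerm s κ j t‖
        ≤ |t| ^ N * (Real.exp ((j : ℝ) * s.re) * ((Real.exp ((j + 1 : ℕ) : ℝ) * |t|) ^ N')⁻¹ * SchwartzMap.seminorm ℝ N' 0 κ) := by
          gcongr
      _ = Real.exp ((j : ℝ) * s.re) * (|t| ^ N * ((Real.exp ((j + 1 : ℕ) : ℝ) * |t|) ^ N')⁻¹) * SchwartzMap.seminorm ℝ N' 0 κ := by ring
      _ ≤ Real.exp ((j : ℝ) * s.re) * ((Real.exp ((j + 1 : ℕ) : ℝ) * 1) ^ N')⁻¹ * SchwartzMap.seminorm ℝ N' 0 κ := by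
          refine mul_le_mul_of_nonneg_right ?_ (apply_nonneg (SchwartzMap.seminorm ℝ N' 0) κ)
          refine mul_le_mul_of_nonneg_left ?_ (Real.exp_pos _).le
          rw [mul_one, mul_pow, mul_inv, mul_left_comm]
          refine mul_le_of_le_one_right (by positivity) ?_
          rw [← div_eq_mul_inv, div_le_one (by positivity)]
          exact pow_le_pow_right₀ ht hNN'
  have ht' : t ≠ 0 := abs_pos.mp ht0
  have hsum : Summable fun j : ℕ => tdMinusTerm s κ j t := summable_tdMinusTerm s κ ht'
  rw [tdMinus_eq_tsum]
  calc |t| ^ N * ‖∑' j : ℕ, tdMinusTerm s κ j t‖ ≤ |t| ^ N * ∑' j : ℕ, ‖tdMinusTerm s κ j t‖ := by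
        gcongr; exact norm_tsum_le_tsum_norm hsum.norm
    _ = ∑' j : ℕ, |t| ^ N * ‖tdMinusTerm s κ j t‖ := by rw [tsum_mul_left]
    _ ≤ ∑' j : ℕ, Real.exp ((j : ℝ) * s.re) * ((Real.exp ((j + 1 : ℕ) : ℝ) * 1) ^ N')⁻¹ * SchwartzMap.seminorm ℝ N' 0 κ :=
        Summable.tsum_le_tsum hterm (hsum.norm.mul_left _) (summable_tdMinus_bound s κ hN's 1)

end Minus

/-! ### `k⁺ = k⁻` on `(0, ∞)` under the vanishing hypothesis -/

section Equality

variable (s : ℂ) (κ : SchwartzMap ℝ ℂ)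

/-- **The twisted difference equation for `k⁻`** (`t ≠ 0`). [cite: Meyer2005, Lemma 5.10] -/
theorem tdMinus_functional_eq {t : ℝ} (ht : t ≠ 0) :
    tdMinus s κ (Real.exp (-1) * t) - cexp s * tdMinus s κ t = κ t := by
  set A : ℕ → ℂ := fun j => cexp (((j : ℕ) : ℂ) * s) * κ (Real.exp (j : ℝ) * t) with hA
  have hA1 : ∀ j : ℕ, A (j + 1) = cexp s * tdMinusTerm s κ j t := by
    intro j
    rw [hA, tdMinusTerm]
    simp only
    rw [← mul_assoc, ← Complex.exp_add]
    congr 2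
    · push_cast; ring
  have hsum : Summable A := by
    rw [← summable_nat_add_iff 1]
    simp_rw [hA1]
    exact (summable_tdMinusTerm s κ ht).mul_left _
  have h1 : tdMinus s κ (Real.exp (-1) * t) = ∑' j : ℕ, A j := by
    rw [tdMinus]
    refine tsum_congr fun j => ?_
    rw [hA]
    simp only
    rw [← mul_assoc, ← Real.exp_add]
    congr 3
    push_cast; ring
  have h2 : cexp s * tdMinus s κ t = ∑' j : ℕ, A (j + 1) := by
    rw [tdMinus, ← tsum_mul_left]
    exact tsum_congr fun j => (hA1 j).symm
  rw [h1, h2, hsum.tsum_eq_zero_add, add_sub_cancel_right, hA]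
  simp

/-- The defect `D = k⁺ - k⁻` satisfies the homogeneous equation `D(t/e) = e^{s} D(t)` (`t ≠ 0`). [folklore] -/
theorem defect_functional_eq (hs : 0 < s.re) {t : ℝ} (ht : t ≠ 0) :
    tdPlus s κ (Real.exp (-1) * t) - tdMinus s κ (Real.exp (-1) * t) = cexp s * (tdPlus s κ t - tdMinus s κ t) := by
  have h1 := tdPlus_functional_eq s κ hs t
  have h2 := tdMinus_functional_eq s κ ht
  linear_combination h1 - h2

/-- The `1`-periodic function `q(y) = D(e^y) e^{sy}`. [folklore] -/
def defectPeriodic (y : ℝ) : ℂ := (tdPlus s κ (Real.exp y) - tdMinus s κ (Real.exp y)) * cexp (s * y)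

/-- `q` is `1`-periodic. [folklore] -/
theorem defectPeriodic_periodic (hs : 0 < s.re) : Function.Periodic (defectPeriodic s κ) 1 := by
  intro y
  rw [defectPeriodic, defectPeriodic]
  have h := defect_functional_eq s κ hs (Real.exp_pos (y + 1)).ne'
  rw [← Real.exp_add, show -1 + (y + 1) = y by ring] at h
  rw [h, mul_comm (cexp s) _, mul_assoc, ← Complex.exp_add]
  congr 1
  push_cast
  ring_nf

/-- `q` is continuous. [folklore] -/
theorem continuous_defectPeriodic (hs : 0 < s.re) : Continuous (defectPeriodic s κ) := by
  refine continuous_iff_continuousAt.mpr fun y => ?_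
  have h1 : ContinuousAt (fun y => tdPlus s κ (Real.exp y)) y :=
    ((contDiff_tdPlus s κ hs).continuous.continuousAt).comp Real.continuous_exp.continuousAt
  have h2 : ContinuousAt (fun y => tdMinus s κ (Real.exp y)) y :=
    (continuousAt_tdMinus s κ (Real.exp_pos y).ne').comp Real.continuous_exp.continuousAt
  exact (h1.sub h2).mul (by fun_prop : Continuous fun y : ℝ => cexp (s * y)).continuousAt

/-- The integrand `H(u) = κ(e^u) e^{wu}` of the Laplace picture is integrable for `Re w > 0`
(substitution `t = e^u` and Mellin convergence of Schwartz functions). [folklore] -/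
theorem integrable_laplaceIntegrand {w : ℂ} (hw : 0 < w.re) :
    Integrable fun u : ℝ => κ (Real.exp u) * cexp (w * u) := by
  have h1 : MellinConvergent (fun t : ℝ => (fun y : ℝ => κ (Real.exp y)) (Real.log t)) w := by
    refine IntegrableOn.congr_fun (mellinConvergent_schwartz κ hw) (fun t ht => ?_) measurableSet_Ioi
    simp only [Real.exp_log ht]
  exact (mellinConvergent_comp_log_iff (fun y : ℝ => κ (Real.exp y)) w).mp h1

/-- `∫ H = Mκ(w)` (the Laplace transform of `κ ∘ exp` is the Mellin transform of `κ`). [folklore] -/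
theorem integral_laplaceIntegrand (w : ℂ) :
    ∫ u : ℝ, κ (Real.exp u) * cexp (w * u) = mellin (fun t : ℝ => κ t) w := by
  have h := mellin_comp_log (fun y : ℝ => κ (Real.exp y)) w
  rw [laplace] at h
  rw [← h, mellin, mellin]
  refine setIntegral_congr_fun measurableSet_Ioi fun t ht => ?_
  simp only [Real.exp_log ht]

/-- The terms of `k⁺` in the Laplace picture: `tdPlusTerm j (e^y) e^{wy} = -e^{-s} H(y - j)` for
`w = s - 2πin`, `H(u) = κ(e^u) e^{wu}`. [folklore] -/
theorem tdPlusTerm_exp_mul (n : ℤ) (j : ℕ) (y : ℝ) :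
    tdPlusTerm s κ j (Real.exp y) * cexp ((s - 2 * π * n * I) * y) =
      -cexp (-s) * (fun u : ℝ => κ (Real.exp u) * cexp ((s - 2 * π * n * I) * u)) (y + ((-(j : ℤ) : ℤ) : ℝ)) := by
  have hcast : ((-(j : ℤ) : ℤ) : ℝ) = -(j : ℝ) := by push_cast; ring
  simp only [hcast]
  rw [tdPlusTerm, ← Real.exp_add, show -(j : ℝ) + y = y + -(j : ℝ) by ring]
  have hexp : cexp (-((j + 1 : ℕ) : ℂ) * s) * cexp ((s - 2 * π * n * I) * y) =
      cexp (-s) * cexp ((s - 2 * π * n * I) * ((y + -(j : ℝ) : ℝ) : ℂ)) := by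
    rw [← Complex.exp_add, ← Complex.exp_add]
    have : -((j + 1 : ℕ) : ℂ) * s + (s - 2 * π * n * I) * y =
        (-s + (s - 2 * π * n * I) * ((y + -(j : ℝ) : ℝ) : ℂ)) + ((-(n * j) : ℤ) : ℂ) * (2 * π * I) := by
      push_cast; ring
    rw [this, Complex.exp_add (-s + (s - 2 * π * n * I) * ((y + -(j : ℝ) : ℝ) : ℂ)), Complex.exp_int_mul_two_pi_mul_I,
      mul_one]
  linear_combination (-κ (Real.exp (y + -(j : ℝ)))) * hexp

/-- The terms of `k⁻` in the Laplace picture: `tdMinusTerm j (e^y) e^{wy} = e^{-s} H(y + j + 1)`. [folklore] -/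
theorem tdMinusTerm_exp_mul (n : ℤ) (j : ℕ) (y : ℝ) :
    tdMinusTerm s κ j (Real.exp y) * cexp ((s - 2 * π * n * I) * y) =
      cexp (-s) * (fun u : ℝ => κ (Real.exp u) * cexp ((s - 2 * π * n * I) * u)) (y + (((j : ℤ) + 1 : ℤ) : ℝ)) := by
  have hcast : (((j : ℤ) + 1 : ℤ) : ℝ) = ((j + 1 : ℕ) : ℝ) := by push_cast; ring
  simp only [hcast]
  rw [tdMinusTerm, ← Real.exp_add, show ((j + 1 : ℕ) : ℝ) + y = y + ((j + 1 : ℕ) : ℝ) by ring]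
  have hexp : cexp (((j : ℕ) : ℂ) * s) * cexp ((s - 2 * π * n * I) * y) =
      cexp (-s) * cexp ((s - 2 * π * n * I) * ((y + ((j + 1 : ℕ) : ℝ) : ℝ) : ℂ)) := by
    rw [← Complex.exp_add, ← Complex.exp_add]
    have : ((j : ℕ) : ℂ) * s + (s - 2 * π * n * I) * y =
        (-s + (s - 2 * π * n * I) * ((y + ((j + 1 : ℕ) : ℝ) : ℝ) : ℂ)) + ((n * (j + 1) : ℤ) : ℂ) * (2 * π * I) := by
      push_cast; ring
    rw [this, Complex.exp_add (-s + (s - 2 * π * n * I) * ((y + ((j + 1 : ℕ) : ℝ) : ℝ) : ℂ)), Complex.exp_int_mul_two_pi_mul_I,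
      mul_one]
  linear_combination (κ (Real.exp (y + ((j + 1 : ℕ) : ℝ)))) * hexp

/-- **The Fourier coefficients of `q` vanish** when `Mκ(s + 2πik) = 0` for all `k ∈ ℤ`:
`∫₀¹ q(y) e^{-2πiny} dy = -e^{-s} Mκ(s - 2πin) = 0`. [cite: Meyer2005, Lemma 5.10] -/
theorem integral_defectPeriodic_mul_exp (hs : 0 < s.re)
    (hvan : ∀ k : ℤ, mellin (fun t : ℝ => κ t) (s + 2 * π * k * I) = 0) (n : ℤ) :
    ∫ y in (0 : ℝ)..1, defectPeriodic s κ y * cexp (-(2 * π * n * I) * y) = 0 := by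
  set w : ℂ := s - 2 * π * n * I with hw
  set H : ℝ → ℂ := fun u => κ (Real.exp u) * cexp (w * u) with hH
  have hwre : 0 < w.re := by rw [hw]; simpa using hs
  have hint : Integrable H := integrable_laplaceIntegrand κ hwre
  -- `g m = ∫₀¹ H(y + m) dy`, summing to `∫ H = Mκ(w) = 0`
  set g : ℤ → ℂ := fun m => ∫ y in (0 : ℝ)..1, H (y + m) with hg
  have hgsum : HasSum g (∫ u, H u) := hint.hasSum_intervalIntegral_comp_add_int
  have hMw : ∫ u, H u = 0 := by
    rw [hH, integral_laplaceIntegrand κ w, hw, show s - 2 * π * n * I = s + 2 * π * ((-n : ℤ) : ℂ) * I by push_cast; ring]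
    exact hvan (-n)
  -- norms: `∑ ∫₀¹ ‖H(y+m)‖ dy` converges
  set gn : ℤ → ℝ := fun m => ∫ y in (0 : ℝ)..1, ‖H (y + m)‖ with hgn
  have hgnsum : HasSum gn (∫ u, ‖H u‖) := hint.norm.hasSum_intervalIntegral_comp_add_int
  -- the integrand
  have hq : ∀ y : ℝ, defectPeriodic s κ y * cexp (-(2 * π * n * I) * y) =
      tdPlus s κ (Real.exp y) * cexp (w * y) - tdMinus s κ (Real.exp y) * cexp (w * y) := by
    intro y
    rw [defectPeriodic, hw, mul_assoc, ← Complex.exp_add, sub_mul]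
    congr 2 <;> · congr 1; ring
  simp_rw [hq]
  -- (i) the `k⁺` part
  have hplus : ∫ y in (0 : ℝ)..1, tdPlus s κ (Real.exp y) * cexp (w * y) = -cexp (-s) * ∑' j : ℕ, g (-(j : ℤ)) := by
    have hF : ∀ j (y : ℝ), tdPlusTerm s κ j (Real.exp y) * cexp (w * y) = -cexp (-s) * H (y + ((-(j : ℤ) : ℤ) : ℝ)) :=
      fun j y => tdPlusTerm_exp_mul s κ n j y
    have hFint : ∀ j : ℕ, Integrable (fun y : ℝ => tdPlusTerm s κ j (Real.exp y) * cexp (w * y)) (volume.restrict (Ioc 0 1)) := by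
      intro j
      have hc : Continuous fun y : ℝ => tdPlusTerm s κ j (Real.exp y) * cexp (w * y) := by
        have := (contDiff_tdPlusTerm s κ j).continuous
        fun_prop
      exact hc.integrableOn_Ioc
    have hFsum : Summable fun j : ℕ => ∫ y in Ioc (0 : ℝ) 1, ‖tdPlusTerm s κ j (Real.exp y) * cexp (w * y)‖ := by
      have h1 : Summable fun j : ℕ => gn (-(j : ℤ)) :=
        hgnsum.summable.comp_injective (fun a b h => by simpa using h)
      refine (h1.mul_left ‖cexp (-s)‖).congr fun j => ?_
      rw [hgn]
      simp only
      rw [intervalIntegral.integral_of_le zero_le_one, ← integral_const_mul]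
      refine setIntegral_congr_fun measurableSet_Ioc fun y _ => ?_
      simp only [hF j y, norm_mul, norm_neg, hH]
    have h := integral_tsum_of_summable_integral_norm hFint hFsum
    rw [intervalIntegral.integral_of_le zero_le_one]
    have hfun : (fun y : ℝ => tdPlus s κ (Real.exp y) * cexp (w * y)) =
        fun y => ∑' j : ℕ, tdPlusTerm s κ j (Real.exp y) * cexp (w * y) := by
      funext y
      rw [tdPlus_eq_tsum]
      exact (tsum_mul_right).symm
    rw [hfun, ← h, ← tsum_mul_left]
    refine tsum_congr fun j => ?_
    rw [hg]
    simp only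
    rw [intervalIntegral.integral_of_le zero_le_one, ← integral_const_mul]
    exact setIntegral_congr_fun measurableSet_Ioc fun y _ => hF j y
  -- (ii) the `k⁻` part
  have hminus : ∫ y in (0 : ℝ)..1, tdMinus s κ (Real.exp y) * cexp (w * y) = cexp (-s) * ∑' j : ℕ, g ((j : ℤ) + 1) := by
    have hF : ∀ j (y : ℝ), tdMinusTerm s κ j (Real.exp y) * cexp (w * y) = cexp (-s) * H (y + (((j : ℤ) + 1 : ℤ) : ℝ)) :=
      fun j y => tdMinusTerm_exp_mul s κ n j y
    have hFint : ∀ j : ℕ, Integrable (fun y : ℝ => tdMinusTerm s κ j (Real.exp y) * cexp (w * y)) (volume.restrict (Ioc 0 1)) := by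
      intro j
      have hc : Continuous fun y : ℝ => tdMinusTerm s κ j (Real.exp y) * cexp (w * y) := by
        unfold tdMinusTerm
        have := κ.continuous
        fun_prop
      exact hc.integrableOn_Ioc
    have hFsum : Summable fun j : ℕ => ∫ y in Ioc (0 : ℝ) 1, ‖tdMinusTerm s κ j (Real.exp y) * cexp (w * y)‖ := by
      have h1 : Summable fun j : ℕ => gn ((j : ℤ) + 1) :=
        hgnsum.summable.comp_injective (fun a b h => by simpa using h)
      refine (h1.mul_left ‖cexp (-s)‖).congr fun j => ?_
      rw [hgn]
      simp only
      rw [intervalIntegral.integral_of_le zero_le_one, ← integral_const_mul]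
      refine setIntegral_congr_fun measurableSet_Ioc fun y _ => ?_
      simp only [hF j y, norm_mul, hH]
    have h := integral_tsum_of_summable_integral_norm hFint hFsum
    rw [intervalIntegral.integral_of_le zero_le_one]
    have hfun : (fun y : ℝ => tdMinus s κ (Real.exp y) * cexp (w * y)) =
        fun y => ∑' j : ℕ, tdMinusTerm s κ j (Real.exp y) * cexp (w * y) := by
      funext y
      rw [tdMinus_eq_tsum]
      exact (tsum_mul_right).symm
    rw [hfun, ← h, ← tsum_mul_left]
    refine tsum_congr fun j => ?_
    rw [hg]
    simp only
    rw [intervalIntegral.integral_of_le zero_le_one, ← integral_const_mul]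
    exact setIntegral_congr_fun measurableSet_Ioc fun y _ => hF j y
  -- (iii) recombine over `ℤ`
  have hi1 : IntervalIntegrable (fun y : ℝ => tdPlus s κ (Real.exp y) * cexp (w * y)) volume 0 1 := by
    refine (Continuous.intervalIntegrable ?_ 0 1)
    have := (contDiff_tdPlus s κ hs).continuous
    fun_prop
  have hi2 : IntervalIntegrable (fun y : ℝ => tdMinus s κ (Real.exp y) * cexp (w * y)) volume 0 1 := by
    refine ContinuousOn.intervalIntegrable fun y _ => ContinuousAt.continuousWithinAt ?_
    have hc : Continuous fun y : ℝ => cexp (w * y) := by fun_prop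
    exact ((continuousAt_tdMinus s κ (Real.exp_pos y).ne').comp Real.continuous_exp.continuousAt).mul hc.continuousAt
  rw [intervalIntegral.integral_sub hi1 hi2, hplus, hminus]
  have hs1 : Summable fun j : ℕ => g (j : ℤ) := hgsum.summable.comp_injective Nat.cast_injective
  have hs2 : Summable fun j : ℕ => g (-((j : ℤ) + 1)) := hgsum.summable.comp_injective (fun a b h => by simpa using h)
  have hZ : ∑' m : ℤ, g m = (∑' j : ℕ, g (j : ℤ)) + ∑' j : ℕ, g (-((j : ℤ) + 1)) := tsum_of_nat_of_neg_add_one hs1 hs2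
  have hneg : ∑' j : ℕ, g (-(j : ℤ)) = g 0 + ∑' j : ℕ, g (-((j : ℤ) + 1)) := by
    have hs3 : Summable fun j : ℕ => g (-(j : ℤ)) := hgsum.summable.comp_injective (fun a b h => by simpa using h)
    rw [hs3.tsum_eq_zero_add]
    simp
  have hpos : ∑' j : ℕ, g (j : ℤ) = g 0 + ∑' j : ℕ, g ((j : ℤ) + 1) := by
    rw [hs1.tsum_eq_zero_add]
    push_cast
    ring_nf
  have htot : ∑' m : ℤ, g m = 0 := by rw [hgsum.tsum_eq, hMw]
  linear_combination (-cexp (-s)) * hneg + cexp (-s) * hpos + cexp (-s) * hZ - cexp (-s) * htot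

/-- `q` is square integrable on `(0, 1]`. [folklore] -/
theorem memLp_defectPeriodic (hs : 0 < s.re) : MemLp (defectPeriodic s κ) 2 (volume.restrict (Ioc (0 : ℝ) 1)) := by
  have hcont := continuous_defectPeriodic s κ hs
  obtain ⟨C, hC⟩ := isCompact_Icc.exists_bound_of_continuousOn (f := defectPeriodic s κ) (s := Icc (0 : ℝ) 1) hcont.continuousOn
  refine MemLp.of_bound hcont.aestronglyMeasurable C ?_
  filter_upwards [ae_restrict_mem measurableSet_Ioc] with x hx
  exact hC x (Ioc_subset_Icc_self hx)

/-- All Fourier coefficients of `q` on `(0, 1]` vanish. [cite: Meyer2005, Lemma 5.10] -/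
theorem fourierCoeffOn_defectPeriodic (hs : 0 < s.re)
    (hvan : ∀ k : ℤ, mellin (fun t : ℝ => κ t) (s + 2 * π * k * I) = 0) (m : ℤ) :
    fourierCoeffOn zero_lt_one (defectPeriodic s κ) m = 0 := by
  rw [fourierCoeffOn_eq_integral]
  have h := integral_defectPeriodic_mul_exp s κ hs hvan m
  have hfun : (fun x : ℝ => (fourier (-m) (x : AddCircle ((1 : ℝ) - 0))) • defectPeriodic s κ x) =
      fun x : ℝ => defectPeriodic s κ x * cexp (-(2 * π * m * I) * x) := by
    funext x
    rw [fourier_coe_apply, smul_eq_mul, mul_comm]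
    congr 1
    congr 1
    push_cast
    ring
  rw [hfun, h, smul_zero]

/-- A continuous non-negative function with zero integral over `(0, 1]` vanishes on `(0, 1)`. [folklore] -/
theorem eq_zero_of_integral_eq_zero {g : ℝ → ℝ} (hg : Continuous g) (hnn : ∀ x, 0 ≤ g x)
    (h : ∫ x in (0 : ℝ)..1, g x = 0) : ∀ x ∈ Ioo (0 : ℝ) 1, g x = 0 := by
  rw [intervalIntegral.integral_of_le zero_le_one,
    integral_eq_zero_iff_of_nonneg (fun x => hnn x) hg.integrableOn_Ioc] at h
  intro x hx
  by_contra hne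
  have hpos : 0 < g x := lt_of_le_of_ne (hnn x) (Ne.symm hne)
  have hopen : IsOpen ({y | 0 < g y} ∩ Ioo 0 1) := (isOpen_lt continuous_const hg).inter isOpen_Ioo
  have hvol : 0 < volume ({y | 0 < g y} ∩ Ioo (0 : ℝ) 1) := hopen.measure_pos volume ⟨x, hpos, hx⟩
  have hzero : volume.restrict (Ioc (0 : ℝ) 1) {y | g y ≠ 0} = 0 := by
    have := h
    rw [Filter.EventuallyEq, ae_iff] at this
    simpa using this
  rw [Measure.restrict_apply' measurableSet_Ioc] at hzero
  have hsub : {y | 0 < g y} ∩ Ioo (0 : ℝ) 1 ⊆ {y | g y ≠ 0} ∩ Ioc 0 1 := fun y hy => ⟨hy.1.ne', Ioo_subset_Ioc_self hy.2⟩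
  exact absurd (measure_mono_null hsub hzero) hvol.ne'

/-- **`q ≡ 0`** (Parseval). [cite: Meyer2005, Lemma 5.10] -/
theorem defectPeriodic_eq_zero (hs : 0 < s.re)
    (hvan : ∀ k : ℤ, mellin (fun t : ℝ => κ t) (s + 2 * π * k * I) = 0) (y : ℝ) :
    defectPeriodic s κ y = 0 := by
  have hcont := continuous_defectPeriodic s κ hs
  -- Parseval: `∫₀¹ ‖q‖² = 0`
  have hpars := hasSum_sq_fourierCoeffOn zero_lt_one (memLp_defectPeriodic s κ hs)
  simp only [fourierCoeffOn_defectPeriodic s κ hs hvan, norm_zero] at hpars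
  have hsum : HasSum (fun _ : ℤ => (0 : ℝ)) (((1 : ℝ) - 0)⁻¹ • ∫ x in (0 : ℝ)..1, ‖defectPeriodic s κ x‖ ^ 2) := by
    simpa using hpars
  have hint : ∫ x in (0 : ℝ)..1, ‖defectPeriodic s κ x‖ ^ 2 = 0 := by
    have h := hsum.tsum_eq
    rw [tsum_zero] at h
    simpa using h.symm
  -- hence `q = 0` on `(0, 1)`, then on `[0, 1]` by continuity, then everywhere by periodicity
  have hIoo : ∀ x ∈ Ioo (0 : ℝ) 1, defectPeriodic s κ x = 0 := by
    intro x hx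
    have h := eq_zero_of_integral_eq_zero (g := fun x => ‖defectPeriodic s κ x‖ ^ 2) (by fun_prop)
      (fun x => by positivity) hint x hx
    simpa using h
  have hIcc : ∀ x ∈ Icc (0 : ℝ) 1, defectPeriodic s κ x = 0 := by
    have hclosed : IsClosed {x : ℝ | defectPeriodic s κ x = 0} := isClosed_eq hcont continuous_const
    have hsub : closure (Ioo (0 : ℝ) 1) ⊆ {x : ℝ | defectPeriodic s κ x = 0} :=
      hclosed.closure_subset_iff.mpr fun x hx => hIoo x hx
    rw [closure_Ioo zero_ne_one] at hsub
    exact fun x hx => hsub hx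
  have hper := defectPeriodic_periodic s κ hs
  have h := hper.sub_int_mul_eq ⌊y⌋ (x := y)
  rw [mul_one] at h
  rw [← h]
  exact hIcc _ ⟨Int.fract_nonneg y, (Int.fract_lt_one y).le⟩

/-- **`k⁺ = k⁻` on `(0, ∞)`.** [cite: Meyer2005, Lemma 5.10] -/
theorem tdPlus_eq_tdMinus (hs : 0 < s.re)
    (hvan : ∀ k : ℤ, mellin (fun t : ℝ => κ t) (s + 2 * π * k * I) = 0) {t : ℝ} (ht : 0 < t) :
    tdPlus s κ t = tdMinus s κ t := by
  have h := defectPeriodic_eq_zero s κ hs hvan (Real.log t)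
  rw [defectPeriodic, Real.exp_log ht, mul_eq_zero] at h
  rcases h with h | h
  · exact sub_eq_zero.mp h
  · exact absurd h (Complex.exp_ne_zero _)

end Equality

/-! ### `k⁺` is a Schwartz function -/

section Schwartz

/-- **Decay of `k⁺` (order zero)**: `|t|^N ‖k⁺(t)‖` is bounded, for `κ` of parity `σ` with
`Mκ(s + 2πik) = 0` for all `k`. [cite: Meyer2005, Lemma 5.10] -/
theorem norm_tdPlus_le (s : ℂ) (κ : SchwartzMap ℝ ℂ) (hs : 0 < s.re) {σ : ℂ} (hpar : ∀ t, κ (-t) = σ * κ t)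
    (hvan : ∀ k : ℤ, mellin (fun t : ℝ => κ t) (s + 2 * π * k * I) = 0) (N : ℕ) :
    ∃ C : ℝ, ∀ t : ℝ, |t| ^ N * ‖tdPlus s κ t‖ ≤ C := by
  obtain ⟨C₁, hC₁⟩ := norm_tdMinus_le s κ N
  obtain ⟨C₀, hC₀⟩ := norm_iteratedFDeriv_tdPlus_le s κ hs 0
  have hC₀' : ∀ t, ‖tdPlus s κ t‖ ≤ C₀ := fun t => by simpa [norm_iteratedFDeriv_zero] using hC₀ t
  refine ⟨max (max C₁ (‖σ‖ * C₁)) C₀, fun t => ?_⟩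
  rcases le_or_gt 1 |t| with ht | ht
  · rcases le_or_gt 0 t with ht0 | ht0
    · -- `t ≥ 1`
      have htpos : 0 < t := by rw [abs_of_nonneg ht0] at ht; linarith
      rw [tdPlus_eq_tdMinus s κ hs hvan htpos]
      exact (hC₁ t ht).trans ((le_max_left _ _).trans (le_max_left _ _))
    · -- `t ≤ -1`: parity
      have htpos : 0 < -t := by linarith
      have hpar' : tdPlus s κ t = σ * tdPlus s κ (-t) := by
        have := tdPlus_neg s κ hpar (-t)
        rwa [neg_neg] at this
      rw [hpar', tdPlus_eq_tdMinus s κ hs hvan htpos, norm_mul]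
      have h := hC₁ (-t) (by rwa [abs_neg])
      rw [abs_neg] at h
      calc |t| ^ N * (‖σ‖ * ‖tdMinus s κ (-t)‖) = ‖σ‖ * (|t| ^ N * ‖tdMinus s κ (-t)‖) := by ring
        _ ≤ ‖σ‖ * C₁ := by gcongr
        _ ≤ max (max C₁ (‖σ‖ * C₁)) C₀ := (le_max_right _ _).trans (le_max_left _ _)
  · -- `|t| < 1`
    calc |t| ^ N * ‖tdPlus s κ t‖ ≤ 1 * C₀ := by
          gcongr
          · exact pow_le_one₀ (abs_nonneg t) ht.le
          · exact hC₀' t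
      _ ≤ max (max C₁ (‖σ‖ * C₁)) C₀ := by rw [one_mul]; exact le_max_right _ _

/-- **Decay of all derivatives of `k⁺`**, by induction on the order: the derivative of `k⁺` is the
`k⁺` attached to `(s + 1, e κ')`, which satisfies the same hypotheses. [cite: Meyer2005, Lemma 5.10] -/
theorem norm_iteratedDeriv_tdPlus_le (n : ℕ) : ∀ (s : ℂ) (κ : SchwartzMap ℝ ℂ), 0 < s.re → ∀ {σ : ℂ},
    (∀ t, κ (-t) = σ * κ t) → (∀ k : ℤ, mellin (fun t : ℝ => κ t) (s + 2 * π * k * I) = 0) →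
      ∀ N : ℕ, ∃ C : ℝ, ∀ t : ℝ, |t| ^ N * ‖iteratedDeriv n (tdPlus s κ) t‖ ≤ C := by
  induction n with
  | zero =>
      intro s κ hs σ hpar hvan N
      simpa [iteratedDeriv_zero] using norm_tdPlus_le s κ hs hpar hvan N
  | succ n ih =>
      intro s κ hs σ hpar hvan N
      have hs' : 0 < (s + 1).re := by simp; linarith
      obtain ⟨C, hC⟩ := ih (s + 1) (scaledDeriv κ) hs' (σ := -σ) (scaledDeriv_neg κ hpar)
        (mellin_scaledDeriv_eq_zero κ hs hvan) N
      refine ⟨C, fun t => ?_⟩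
      rw [iteratedDeriv_succ', deriv_tdPlus s κ hs]
      exact hC t

/-- **THE SOLUTION OF THE TWISTED DIFFERENCE EQUATION IN `𝒮(ℝ)`.** For a Schwartz function `κ`
of parity `σ` (`κ(-t) = σ κ(t)`), `Re s > 0`, with `Mκ(s + 2πik) = 0` for all `k ∈ ℤ`, there is a
Schwartz function `k` of the same parity with `k(t/e) - e^{s} k(t) = κ(t)` for all `t`
(namely `k = k⁺`). [cite: Meyer2005, Lemma 5.10] -/
theorem exists_schwartz_twistedDifference (κ : SchwartzMap ℝ ℂ) {σ : ℂ} (hpar : ∀ t, κ (-t) = σ * κ t)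
    {s : ℂ} (hs : 0 < s.re) (hvan : ∀ k : ℤ, mellin (fun t : ℝ => κ t) (s + 2 * π * k * I) = 0) :
    ∃ k : SchwartzMap ℝ ℂ, (∀ t, k (-t) = σ * k t) ∧ (∀ t, k (Real.exp (-1) * t) - cexp s * k t = κ t) ∧
      ⇑k = tdPlus s κ := by
  let k : SchwartzMap ℝ ℂ :=
    { toFun := tdPlus s κ
      smooth' := contDiff_tdPlus s κ hs
      decay' := fun N n => by
        obtain ⟨C, hC⟩ := norm_iteratedDeriv_tdPlus_le n s κ hs hpar hvan N
        refine ⟨C, fun t => ?_⟩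
        rw [norm_iteratedFDeriv_eq_norm_iteratedDeriv, Real.norm_eq_abs]
        exact hC t }
  exact ⟨k, fun t => tdPlus_neg s κ hpar t, fun t => tdPlus_functional_eq s κ hs t, rfl⟩

end Schwartz

end Literature.NumberTheory.Automorphic.Meyer
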